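import Summits.QuantumFields.BalabanUV.Beta.GAN24.VHWordsZeroCell
import Summits.QuantumFields.BalabanUV.Beta.GAN24.ExitFaceLeftFamily
import Summits.QuantumFields.BalabanUV.Beta.GAN24.ExitFaceCurrentCellTotalsStep
import Summits.QuantumFields.BalabanUV.Beta.GAN24.ExitFaceCurrentDivFree
import Summits.QuantumFields.BalabanUV.Beta.GAN24.PeriodicCurrentFaceFlux

/-!
# `BalabanUV.Beta.GAN24.EVHLatticeWordsSucc` — binder row G-an2-4 ∕ (CONV-C), W-slot CT-W, conservation law (C)∕(C)sym AT ALL LEVELS, 27_j of this lineage's ledger of the 18 sector words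
# (`HOME/b2b-balaban-gan24-formalise-leaf-04/g69/CURRENT-SYM-TOWER.md` §5): **THE `S^E_c ⊗ S′_{u′}` WORD WITH THE BORDER SLOT ON THE LATTICE BOND AND ITS SWAP VANISH IN THE ZERO MODE AT
# LEVEL `j+1`, FOR EVERY `j`** — 27 `VHWordsZeroCell.sum_box_wilson_border_word_eq_zero` (Wilson E-table, every kernel level) with the cubic sector `S^E_{j+1} = (Lc^{d+1}·wE_{j+1}) •
# e3OfK Lc G_j (SrecAt j)` in place of `cE • wilsonA`; the one table-specific input — the exit-FACE FLUX over a cell of the bond-resummed face-weighted left family — is supplied by the slab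
# lemma (`PeriodicCurrentFaceFlux`) from the (P)(D)(Z) properties of the level-`(j+1)` exit-face current (C `tsum_current_periodic`, g68 `ExitFaceCurrentDivFree.exitFace_pairCurrent_divFree`,
# E `ExitFaceCurrentCellTotalsStep.sum_box_current_E_eq_zero`).

NOT IN PRINT; OUR BOOKKEEPING ([folklore] BY NAME over this lineage's 27 `VHWordsZeroCell` (§2 `tsum_ffLeft_profile_right_word_eq`, `hasSum_(sgnK_)dressedStep_fm_col`, `sum_(neg_)fmCharge_mul`),
leaf-06 g52's `ExitFaceLeftFamily` (`leftFamily_cov_of_translate`, `summable_leftFamily_mul_of_locStencil`, `tsum_leftFamily_eq_faceface` — the GENERIC-table left family), C `VHWordsZeroLatticeStep`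
(`exists_locStencil_e3Sector`, `e3Sector_translate`, `e3Sector_inr_right`, `unitS_e3Sector_antisymm`, `vertexE_translate`, `tsum_current_periodic`), D `ExitFaceCurrentCellTotals.tsum_weight_current_eq_faceSlot`,
E, g68 `ExitFaceCurrentDivFree`, this gen's `PeriodicCurrentFaceFlux.sum_box_face_current_eq_zero`, leaf-04's `CoarseBondCellPairing`; G-an2-4 formalisation swarm, leaf prover
`b2b-balaban-gan24-formalise-leaf-04`, gen 69).  HONEST FRAMING (cell contract, verbatim): «discharging `BetaPertH` makes Bałaban's UV stability UNCONDITIONAL — a real constructive-QFT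
result; it is NOT the continuum limit and NOT the Clay problem.»  HONEST DEPENDENCY (verbatim): «continuum YM on T⁴ ⇐ BetaPertH ∧ nine spine estimates (0/9 proved); BetaPertH ⇐ (D1) ∧ (D4) ∧
CAP+tail; G-an2-4 gates asym, D1 and NE2/3/4.»

WHAT ([folklore]; generic `d`, `3 ≤ Lc`, in-block root, every `j`, all units `s_f s_m`, every `cΛ`, E's Ward pins `cE = Lc^{d+1}`, `cVH = −Lc^{d+1}·½·Lc^{d+1}`; `S′` ANY local stencil family
with no ff block, block-covariant, multiplier first (resp. second) legs coarse; 0 `def`, 0 cited facts, 0 `def … : Prop`, 0 sorry): §1 `vertexE_inl_inr`; §2 `tsum_leftFamily_eq_neg_current`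
(the bond-resummed face-weighted left family of `S^E_{j+1}` IS minus the exit-face pair current of C∕D∕E); §3 **`sum_box_leftFamily_face_eq_zero_succ`** (27's cell identity at level `j+1`);
§4 **`sum_box_E_border_word_eq_zero_succ`** (direct) and **`sum_box_border_E_swap_word_eq_zero_succ`** (swap).  Asserts NO value of Bałaban's tables; discharges NOTHING of (C)sym ∕ (Q-D) ∕
(Q-D-rate) ∕ «T2Shape» ∕ «T2Drift» ∕ (hW, hWall); NEVER «G-an2-4 closed» as (CONV-C); NOT D1, NOT `BetaPertH`, NOT continuum, NOT Clay.  2026-08-23; no existing file touched.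
-/

noncomputable section

open Finset
open scoped BigOperators
open Literature.MathematicalPhysics.QuantumFieldTheory
open Literature.MathematicalPhysics.QuantumFieldTheory.Balaban1983to89
open Literature.MathematicalPhysics.QuantumFieldTheory.Balaban1983to89.Beta
open B12Sec2to5 (l1 l1_nonneg)
open ExpKernelCalculus (Site MKer comp shiftK Decays BiLoc VertexFamily Zl Zl_nonneg)
open OneStepResolventKernel (Fib LocStencil wsum decays_mono biLoc_mono)
open BalabanStepJetsSucc (biLoc_comp_right wE)
open OneStepKernelFamily (KInvStep vertexOfK vertexFamily_vertexOfK decays_KInvStep)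
open AffineAveraging (Form1 box toSite unitVec)
open AveragingContours (off)
open PeriodicDescent (IsPeriodic)
open Summit.QuantumFields.BalabanUV.Beta.TameKernelCalculus (trK trK_apply trK_comp biLoc_trK Loc Spr Tame comp_assoc_tame comp_neg_left)
open Summit.QuantumFields.BalabanUV.Beta.BorderedHessian (sgnK sgnK_apply sgnF_inl sgnF_inr decays_sgnK)
open Summit.QuantumFields.BalabanUV.Beta.BubbleParity (trK_vertexOfK_of_antisymm vertexOfK_apply_eq_zero)
open Summit.QuantumFields.BalabanUV.Beta.AxialDressingRooted (coDressKBmAt decays_coDressKBmAt)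
open Summit.QuantumFields.BalabanUV.Beta.HessKerDressedUnits (unitK unitS unitS_apply decays_unitK locStencil_unitS)
open Summit.QuantumFields.BalabanUV.Beta.SpineRooted (e3OfK)
open Summit.QuantumFields.BalabanUV.Beta.WardLocusRecursive (SrecAt)
open Summit.QuantumFields.BalabanUV.Beta.GAN24.CoarseBondCellPairing (sum_box_tsum_sum_mul_periodic_of_cov)
open Summit.QuantumFields.BalabanUV.Beta.GAN24.LayerCommutatorAntisymm (trK_unitK_coDress)
open Summit.QuantumFields.BalabanUV.Beta.GAN24.ExchangeSlotResum (tsum_twoFace_eq_trK face_weight_periodic)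
open Summit.QuantumFields.BalabanUV.Beta.GAN24.VHWordsZeroLattice (vertexOfK_unitS_noFF_inl_inl)
open Summit.QuantumFields.BalabanUV.Beta.GAN24.VHWordsZeroBorder (borderSlot_translate borderSlot_inr_fst_eq_zero borderSlot_inr_snd_eq_zero)
open Summit.QuantumFields.BalabanUV.Beta.GAN24.VHWordsZeroCell (tsum_ffLeft_profile_right_word_eq hasSum_dressedStep_fm_col hasSum_sgnK_dressedStep_fm_col sum_fmCharge_mul sum_neg_fmCharge_mul)
open Summit.QuantumFields.BalabanUV.Beta.GAN24.ExitFaceLeftFamily (leftFamily_cov_of_translate summable_leftFamily_mul_of_locStencil tsum_leftFamily_eq_faceface)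
open Summit.QuantumFields.BalabanUV.Beta.GAN24.VHWordsZeroLatticeStep (exists_locStencil_e3Sector e3Sector_translate e3Sector_inr_right unitS_e3Sector_antisymm vertexE_translate tsum_current_periodic)
open Summit.QuantumFields.BalabanUV.Beta.GAN24.ExitFaceCurrentCellTotals (tsum_weight_current_eq_faceSlot)
open Summit.QuantumFields.BalabanUV.Beta.GAN24.ExitFaceCurrentCellTotalsStep (sum_box_current_E_eq_zero)
open Summit.QuantumFields.BalabanUV.Beta.GAN24.ExitFaceCurrentDivFree (exitFace_pairCurrent_divFree)
open Summit.QuantumFields.BalabanUV.Beta.GAN24.PeriodicCurrentFaceFlux (sum_box_face_current_eq_zero)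

namespace Summit.QuantumFields.BalabanUV.Beta.GAN24.EVHLatticeWordsSucc

variable {d : ℕ} {Lc : ℕ} [NeZero Lc] {r : Fin (d + 1) → ℕ}

/-! ## §1 The cubic-sector vertex has no field–multiplier block -/

/-- [folklore] `V^E_{μ,c} y z (inl α′) (inr m) = 0` (the cubic sector has no multiplier second legs). -/
theorem vertexE_inl_inr (sf sm cE cVH cΛ : ℝ) (j : ℕ) (X : MKer (d + 1) (Fib d)) (μ : Fin (d + 1)) (c y z : Site (d + 1)) (α' m : Fin (d + 1)) :
    vertexOfK X Lc (unitS sf sm (fun κ t => (cE * wE d Lc (j + 1)) • e3OfK Lc (coDressKBmAt (toSite r) Lc (KInvStep (d := d) Lc j)) (SrecAt d Lc (toSite r) cE cVH cΛ j) κ t))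
      μ c y z (Sum.inl α') (Sum.inr m) = 0 :=
  vertexOfK_apply_eq_zero (a := Sum.inl α') (b := Sum.inr m) (fun κ' t x z' => by simp only [unitS_apply, e3Sector_inr_right, mul_zero, zero_mul]) μ c y z

/-! ## §2 The bond-resummed left family is minus the exit-face pair current -/

/-- [folklore] **`Σ'_u j_u(a, z) = −T_E(a, z)`**: with `j_u(a,z) = Σ'_y 𝟙f(y_γ)·V^E_{μ,u} y z (inl γ)(inl a)` (weighted leg first) and C∕D∕E's current
`T_E(a, z) = Σ'_{(u,w)} 𝟙f(w_γ)·V^E_{μ,u} z w (inl a)(inl γ)` (free leg first), both resum to the face-slot two-face current (leaf-06 `tsum_leftFamily_eq_faceface`, D `tsum_weight_current_eq_faceSlot`),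
and the unit-dressed cubic sector is leg-antisymmetric (C `unitS_e3Sector_antisymm`). -/
theorem tsum_leftFamily_eq_neg_current (hr : r ∈ box (d + 1) Lc) (sf sm cE cVH cΛ : ℝ) (j : ℕ) (μ γ a : Fin (d + 1)) (z : Site (d + 1)) :
    ∑' u : Site (d + 1), ∑' y : Site (d + 1), (if y γ % (Lc : ℤ) = (Lc : ℤ) - 1 then (1 : ℝ) else 0) *
        vertexOfK (unitK sf sm (coDressKBmAt (toSite r) Lc (KInvStep (d := d) Lc (j + 1)))) Lc
          (unitS sf sm (fun κ t => (cE * wE d Lc (j + 1)) • e3OfK Lc (coDressKBmAt (toSite r) Lc (KInvStep (d := d) Lc j)) (SrecAt d Lc (toSite r) cE cVH cΛ j) κ t)) μ u y z (Sum.inl γ) (Sum.inl a) =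
      -∑' uw : Site (d + 1) × Site (d + 1), (if uw.2 γ % (Lc : ℤ) = (Lc : ℤ) - 1 then (1 : ℝ) else 0) *
        vertexOfK (unitK sf sm (coDressKBmAt (toSite r) Lc (KInvStep (d := d) Lc (j + 1)))) Lc
          (unitS sf sm (fun κ t => (cE * wE d Lc (j + 1)) • e3OfK Lc (coDressKBmAt (toSite r) Lc (KInvStep (d := d) Lc j)) (SrecAt d Lc (toSite r) cE cVH cΛ j) κ t)) μ uw.1 z uw.2 (Sum.inl a) (Sum.inl γ) := by
  have hLc : 1 ≤ Lc := Nat.one_le_iff_ne_zero.mpr (NeZero.ne Lc)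
  obtain ⟨CE, δE, hδE, hSE⟩ := exists_locStencil_e3Sector (d := d) hLc hr cE cVH cΛ j
  have hS := locStencil_unitS (sf := sf) (sm := sm) hSE
  have hχ : ∀ w : Site (d + 1), |(if w γ % (Lc : ℤ) = (Lc : ℤ) - 1 then (1 : ℝ) else 0)| ≤ 1 := fun w => by split_ifs <;> simp
  rw [tsum_leftFamily_eq_faceface (μ := μ) (α := γ) hLc hr hSE hδE sf sm (j + 1) a z, tsum_weight_current_eq_faceSlot hLc hr sf sm (j + 1) hS hδE hχ μ z (Sum.inl a) (Sum.inl γ), ← mul_neg,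
    ← tsum_neg]
  congr 1
  refine tsum_congr fun y => ?_
  rw [← mul_neg, ← tsum_neg]
  congr 1
  refine tsum_congr fun t => ?_
  split_ifs
  · exact unitS_e3Sector_antisymm hLc hr sf sm cE cVH cΛ j μ t z y (Sum.inl a) (Sum.inl γ)
  · rw [neg_zero]

/-! ## §3 The cell identity at level `j+1` -/

/-- [folklore] **THE ZERO-MODE CELL IDENTITY FOR THE FACE-WEIGHTED LEFT FAMILY OF THE CUBIC SECTOR AT LEVEL `j+1`** (`3 ≤ Lc`, E's pins, any `μ γ`, any coefficients `κ_a`):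
`Σ_{c∈box Lc} Σ'_{y₁} Σ_a j^γ_{toSite c}(a, y₁)·(𝟙f((y₁)_a)·κ_a) = 0` — covariance regroups the cell sum into `|box|·Σ_{r′∈cell}Σ_a (Σ'_v j^γ_v)(a, r′)·𝟙f(r′_a)κ_a` (`CoarseBondCellPairing` with leaf-06's
generic left-family lemmas), `Σ'_v j^γ_v = −T_E` (§2), and the exit-face flux of `T_E` over the cell vanishes by the slab lemma from (P)(D)(Z). -/
theorem sum_box_leftFamily_face_eq_zero_succ (hLc : 3 ≤ Lc) (hr : r ∈ box (d + 1) Lc) (sf sm cΛ : ℝ) (j : ℕ) (μ γ : Fin (d + 1)) (κ : Fin (d + 1) → ℝ) :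
    ∑ c ∈ box (d + 1) Lc, ∑' y₁ : Site (d + 1), ∑ a : Fin (d + 1),
        (∑' y : Site (d + 1), (if y γ % (Lc : ℤ) = (Lc : ℤ) - 1 then (1 : ℝ) else 0) *
          vertexOfK (unitK sf sm (coDressKBmAt (toSite r) Lc (KInvStep (d := d) Lc (j + 1)))) Lc
            (unitS sf sm (fun κ' t => ((Lc : ℝ) ^ (d + 1) * wE d Lc (j + 1)) • e3OfK Lc (coDressKBmAt (toSite r) Lc (KInvStep (d := d) Lc j))
              (SrecAt d Lc (toSite r) ((Lc : ℝ) ^ (d + 1)) (-((Lc : ℝ) ^ (d + 1) * (1 / 2) * (Lc : ℝ) ^ (d + 1))) cΛ j) κ' t)) μ (toSite c) y y₁ (Sum.inl γ) (Sum.inl a)) *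
        ((if y₁ a % (Lc : ℤ) = (Lc : ℤ) - 1 then (1 : ℝ) else 0) * κ a) = 0 := by
  classical
  have hLc1 : 1 ≤ Lc := le_trans (by norm_num) hLc
  obtain ⟨CE, δE, hδE, hSE⟩ := exists_locStencil_e3Sector (d := d) hLc1 hr ((Lc : ℝ) ^ (d + 1)) (-((Lc : ℝ) ^ (d + 1) * (1 / 2) * (Lc : ℝ) ^ (d + 1))) cΛ j
  have hSt := fun (κ' : Fin (d + 1)) (u v : Site (d + 1)) => e3Sector_translate (r := r) (d := d) hLc1 ((Lc : ℝ) ^ (d + 1)) (-((Lc : ℝ) ^ (d + 1) * (1 / 2) * (Lc : ℝ) ^ (d + 1))) cΛ j κ' u v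
  have hAp : ∀ (a : Fin (d + 1)) (y s : Site (d + 1)), (if (y + (Lc : ℤ) • s) a % (Lc : ℤ) = (Lc : ℤ) - 1 then (1 : ℝ) else 0) * κ a = (if y a % (Lc : ℤ) = (Lc : ℤ) - 1 then (1 : ℝ) else 0) * κ a :=
    fun a y s => by rw [face_weight_periodic Lc a y s]
  have hAb : ∀ (a : Fin (d + 1)) (y : Site (d + 1)), |(if y a % (Lc : ℤ) = (Lc : ℤ) - 1 then (1 : ℝ) else 0) * κ a| ≤ ∑ a' : Fin (d + 1), |κ a'| := by
    intro a y
    have h1 : |(if y a % (Lc : ℤ) = (Lc : ℤ) - 1 then (1 : ℝ) else 0) * κ a| ≤ |κ a| := by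
      rw [abs_mul]; exact mul_le_of_le_one_left (abs_nonneg _) (by split_ifs <;> simp)
    exact h1.trans (Finset.single_le_sum (f := fun a' => |κ a'|) (fun _ _ => abs_nonneg _) (Finset.mem_univ a))
  rw [sum_box_tsum_sum_mul_periodic_of_cov (N := Lc)
    (j := fun (u : Site (d + 1)) (a : Fin (d + 1)) (y₁ : Site (d + 1)) => ∑' y : Site (d + 1), (if y γ % (Lc : ℤ) = (Lc : ℤ) - 1 then (1 : ℝ) else 0) *
      vertexOfK (unitK sf sm (coDressKBmAt (toSite r) Lc (KInvStep (d := d) Lc (j + 1)))) Lc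
        (unitS sf sm (fun κ' t => ((Lc : ℝ) ^ (d + 1) * wE d Lc (j + 1)) • e3OfK Lc (coDressKBmAt (toSite r) Lc (KInvStep (d := d) Lc j))
          (SrecAt d Lc (toSite r) ((Lc : ℝ) ^ (d + 1)) (-((Lc : ℝ) ^ (d + 1) * (1 / 2) * (Lc : ℝ) ^ (d + 1))) cΛ j) κ' t)) μ u y y₁ (Sum.inl γ) (Sum.inl a))
    (A := fun a y₁ => (if y₁ a % (Lc : ℤ) = (Lc : ℤ) - 1 then (1 : ℝ) else 0) * κ a)
    (fun u a y₁ t => leftFamily_cov_of_translate (r := r) (μ := μ) (α := γ) hLc1 hSt sf sm (j + 1) u a y₁ t) (fun a y s => hAp a y s)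
    (fun u a => summable_leftFamily_mul_of_locStencil (μ := μ) (α := γ) hLc1 hr hSE hδE sf sm (j + 1) (fun y => hAb a y) u a)]
  refine mul_eq_zero_of_right _ ?_
  simp only [tsum_leftFamily_eq_neg_current hr sf sm _ _ cΛ j μ γ]
  -- the slab lemma for the exit-face pair current `T_E`
  have hflux := fun a : Fin (d + 1) => sum_box_face_current_eq_zero (N := Lc)
    (T := fun b z => ∑' uw : Site (d + 1) × Site (d + 1), (if uw.2 γ % (Lc : ℤ) = (Lc : ℤ) - 1 then (1 : ℝ) else 0) *
      vertexOfK (unitK sf sm (coDressKBmAt (toSite r) Lc (KInvStep (d := d) Lc (j + 1)))) Lc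
        (unitS sf sm (fun κ' t => ((Lc : ℝ) ^ (d + 1) * wE d Lc (j + 1)) • e3OfK Lc (coDressKBmAt (toSite r) Lc (KInvStep (d := d) Lc j))
          (SrecAt d Lc (toSite r) ((Lc : ℝ) ^ (d + 1)) (-((Lc : ℝ) ^ (d + 1) * (1 / 2) * (Lc : ℝ) ^ (d + 1))) cΛ j) κ' t)) μ uw.1 z uw.2 (Sum.inl b) (Sum.inl γ))
    (fun b z s => by
      beta_reduce
      exact tsum_current_periodic (vertexE_translate (r := r) hLc1 sf sm ((Lc : ℝ) ^ (d + 1)) (-((Lc : ℝ) ^ (d + 1) * (1 / 2) * (Lc : ℝ) ^ (d + 1))) cΛ j μ)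
        (ρ := fun w : Site (d + 1) => (if w γ % (Lc : ℤ) = (Lc : ℤ) - 1 then (1 : ℝ) else 0))
        (fun w s' => face_weight_periodic Lc γ w s') (Sum.inl b) (Sum.inl γ) z s)
    (fun z => exitFace_pairCurrent_divFree hr sf sm _ _ cΛ _ j μ γ z) (fun b => sum_box_current_E_eq_zero hLc hr sf sm cΛ j μ γ b) a
  have e : ∀ r' ∈ box (d + 1) Lc, ∑ a : Fin (d + 1),
      (-(∑' uw : Site (d + 1) × Site (d + 1), (if uw.2 γ % (Lc : ℤ) = (Lc : ℤ) - 1 then (1 : ℝ) else 0) *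
        vertexOfK (unitK sf sm (coDressKBmAt (toSite r) Lc (KInvStep (d := d) Lc (j + 1)))) Lc
          (unitS sf sm (fun κ' t => ((Lc : ℝ) ^ (d + 1) * wE d Lc (j + 1)) • e3OfK Lc (coDressKBmAt (toSite r) Lc (KInvStep (d := d) Lc j))
            (SrecAt d Lc (toSite r) ((Lc : ℝ) ^ (d + 1)) (-((Lc : ℝ) ^ (d + 1) * (1 / 2) * (Lc : ℝ) ^ (d + 1))) cΛ j) κ' t)) μ uw.1 (toSite r') uw.2 (Sum.inl a) (Sum.inl γ))) *
        ((if toSite r' a % (Lc : ℤ) = (Lc : ℤ) - 1 then (1 : ℝ) else 0) * κ a) =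
      ∑ a : Fin (d + 1), (-κ a) * ((if toSite r' a % (Lc : ℤ) = (Lc : ℤ) - 1 then (1 : ℝ) else 0) *
        ∑' uw : Site (d + 1) × Site (d + 1), (if uw.2 γ % (Lc : ℤ) = (Lc : ℤ) - 1 then (1 : ℝ) else 0) *
          vertexOfK (unitK sf sm (coDressKBmAt (toSite r) Lc (KInvStep (d := d) Lc (j + 1)))) Lc
            (unitS sf sm (fun κ' t => ((Lc : ℝ) ^ (d + 1) * wE d Lc (j + 1)) • e3OfK Lc (coDressKBmAt (toSite r) Lc (KInvStep (d := d) Lc j))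
              (SrecAt d Lc (toSite r) ((Lc : ℝ) ^ (d + 1)) (-((Lc : ℝ) ^ (d + 1) * (1 / 2) * (Lc : ℝ) ^ (d + 1))) cΛ j) κ' t)) μ uw.1 (toSite r') uw.2 (Sum.inl a) (Sum.inl γ)) :=
    fun r' _ => Finset.sum_congr rfl fun a _ => by ring
  rw [Finset.sum_congr rfl e, Finset.sum_comm]
  refine Finset.sum_eq_zero fun a _ => ?_
  rw [← Finset.mul_sum, hflux a, mul_zero]

/-! ## §4 The words -/

section Words

variable {S' : Fin (d + 1) → Site (d + 1) → MKer (d + 1) (Fib d)} {Cs δs : ℝ} {μ ν α β : Fin (d + 1)}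

/-- [folklore] **27_{j+1}, DIRECT: THE `S^E ⊗ S′` WORD, BORDER SLOT ON THE LATTICE BOND, VANISHES IN THE ZERO MODE AT LEVEL `j+1`** (`3 ≤ Lc`, in-block root, all units, E's pins, any axes;
`S′` any local stencil family with no ff block, block-covariant, multiplier first legs coarse). -/
theorem sum_box_E_border_word_eq_zero_succ (hLc : 3 ≤ Lc) (hr : r ∈ box (d + 1) Lc) (sf sm cΛ : ℝ) (j : ℕ) (hS' : LocStencil S' Cs δs) (hδs : 0 < δs)
    (hS'ff : ∀ (κ' : Fin (d + 1)) (t x z : Site (d + 1)) (α' a : Fin (d + 1)), S' κ' t x z (Sum.inl α') (Sum.inl a) = 0)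
    (hS'cov : ∀ (κ : Fin (d + 1)) (u t : Site (d + 1)), S' κ (u + (Lc : ℤ) • t) = shiftK (-((Lc : ℤ) • t)) (S' κ u))
    (hS'supp : ∀ (κ : Fin (d + 1)) (t z w : Site (d + 1)) (m : Fin (d + 1)) (b : Fib d), off Lc z ≠ 0 → S' κ t z w (Sum.inr m) b = 0) :
    ∑ c ∈ box (d + 1) Lc, ∑' u' : Site (d + 1), ∑' yw : Site (d + 1) × Site (d + 1), (if yw.1 α % (Lc : ℤ) = (Lc : ℤ) - 1 then (1 : ℝ) else 0) * (if yw.2 β % (Lc : ℤ) = (Lc : ℤ) - 1 then (1 : ℝ) else 0) *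
        comp (comp (vertexOfK (unitK sf sm (coDressKBmAt (toSite r) Lc (KInvStep (d := d) Lc (j + 1)))) Lc
            (unitS sf sm (fun κ' t => ((Lc : ℝ) ^ (d + 1) * wE d Lc (j + 1)) • e3OfK Lc (coDressKBmAt (toSite r) Lc (KInvStep (d := d) Lc j))
              (SrecAt d Lc (toSite r) ((Lc : ℝ) ^ (d + 1)) (-((Lc : ℝ) ^ (d + 1) * (1 / 2) * (Lc : ℝ) ^ (d + 1))) cΛ j) κ' t)) μ (toSite c))
          (unitK sf sm (coDressKBmAt (toSite r) Lc (KInvStep (d := d) Lc (j + 1)))))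
          (vertexOfK (unitK sf sm (coDressKBmAt (toSite r) Lc (KInvStep (d := d) Lc (j + 1)))) Lc (unitS sf sm S') ν u') yw.1 yw.2 (Sum.inl α) (Sum.inl β) = 0 := by
  classical
  have hLc1 : 1 ≤ Lc := le_trans (by norm_num) hLc
  set X := unitK sf sm (coDressKBmAt (toSite r) Lc (KInvStep (d := d) Lc (j + 1))) with hX
  set SE : Fin (d + 1) → Site (d + 1) → MKer (d + 1) (Fib d) := fun κ' t => ((Lc : ℝ) ^ (d + 1) * wE d Lc (j + 1)) •
    e3OfK Lc (coDressKBmAt (toSite r) Lc (KInvStep (d := d) Lc j)) (SrecAt d Lc (toSite r) ((Lc : ℝ) ^ (d + 1)) (-((Lc : ℝ) ^ (d + 1) * (1 / 2) * (Lc : ℝ) ^ (d + 1))) cΛ j) κ' t with hSEdef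
  -- common-rate data
  obtain ⟨δK, CK, hδK, hCK, hXd⟩ := decays_coDressKBmAt hLc1 hr (decays_KInvStep (d := d) (Lc := Lc) (j + 1))
  have hXu : Decays X (max |sf| |sm| * CK * max |sf| |sm|) δK := decays_unitK (sf := sf) (sm := sm) hXd
  have hCX : 0 ≤ max |sf| |sm| * CK * max |sf| |sm| := by positivity
  have hCs : 0 ≤ Cs := (hS' 0 0).nonneg (Sum.inl 0)
  obtain ⟨CE, δE, hδE, hSE0⟩ := exists_locStencil_e3Sector (d := d) hLc1 hr ((Lc : ℝ) ^ (d + 1)) (-((Lc : ℝ) ^ (d + 1) * (1 / 2) * (Lc : ℝ) ^ (d + 1))) cΛ j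
  have hCE : 0 ≤ CE := (hSE0 0 0).nonneg (Sum.inl 0)
  set δ₁ : ℝ := min δK (min δs δE) with hδ₁
  have hδ₁0 : 0 < δ₁ := lt_min hδK (lt_min hδs hδE)
  have hX1 : Decays X (max |sf| |sm| * CK * max |sf| |sm|) δ₁ := decays_mono hXu hCX le_rfl (min_le_left _ _)
  have hSE : LocStencil (unitS sf sm SE) _ δ₁ := locStencil_unitS (sf := sf) (sm := sm) (fun κ' u => biLoc_mono (hSE0 κ' u) hCE ((min_le_right _ _).trans (min_le_right _ _)))
  have hVE := vertexFamily_vertexOfK (N := Lc) hX1 hCX hSE hδ₁0 le_rfl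
  have hQ := vertexFamily_vertexOfK (N := Lc) hX1 hCX (locStencil_unitS (sf := sf) (sm := sm) (fun κ' u => biLoc_mono (hS' κ' u) hCs ((min_le_right _ _).trans (min_le_left _ _)))) hδ₁0 le_rfl
  have hCv := (hVE μ 0).nonneg (Sum.inl 0)
  have hCq := (hQ μ 0).nonneg (Sum.inl 0)
  have hX2 : Decays X (max |sf| |sm| * CK * max |sf| |sm|) (δ₁ / 2) := decays_mono hX1 hCX le_rfl (by linarith)
  -- per bond: 27 §2
  have hval : ∀ c : Site (d + 1), (∑' u' : Site (d + 1), ∑' yw : Site (d + 1) × Site (d + 1), (if yw.1 α % (Lc : ℤ) = (Lc : ℤ) - 1 then (1 : ℝ) else 0) * (if yw.2 β % (Lc : ℤ) = (Lc : ℤ) - 1 then (1 : ℝ) else 0) *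
        comp (comp (vertexOfK X Lc (unitS sf sm SE) μ c) X) (vertexOfK X Lc (unitS sf sm S') ν u') yw.1 yw.2 (Sum.inl α) (Sum.inl β)) =
      ∑' y₁ : Site (d + 1), ∑ a : Fin (d + 1), (∑' y : Site (d + 1), (if y α % (Lc : ℤ) = (Lc : ℤ) - 1 then (1 : ℝ) else 0) * vertexOfK X Lc (unitS sf sm SE) μ c y y₁ (Sum.inl α) (Sum.inl a)) *
        ((if y₁ a % (Lc : ℤ) = (Lc : ℤ) - 1 then (1 : ℝ) else 0) * (((Lc : ℝ) * (sm * sf)) * ((((Lc ^ (j + 1 + 1) : ℕ) : ℝ)) ^ (d + 1 + 1))⁻¹ *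
          (∑' uw : Site (d + 1) × Site (d + 1), (if uw.2 β % (Lc : ℤ) = (Lc : ℤ) - 1 then (1 : ℝ) else 0) * vertexOfK X Lc (unitS sf sm S') ν uw.1 0 uw.2 (Sum.inr a) (Sum.inl β)))) := by
    intro c
    have hA := biLoc_comp_right (hVE μ c) hX2 (show (0 : ℝ) ≤ δ₁ / 4 by positivity) (by linarith)
    rw [tsum_ffLeft_profile_right_word_eq (N := Lc) (α := α) (β := β) (ρ₁ := fun y : Site (d + 1) => (if y α % (Lc : ℤ) = (Lc : ℤ) - 1 then (1 : ℝ) else 0))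
      (ρ₂ := fun w : Site (d + 1) => (if w β % (Lc : ℤ) = (Lc : ℤ) - 1 then (1 : ℝ) else 0)) (show (0 : ℝ) < δ₁ / 4 by positivity) (biLoc_mono (hVE μ c) hCv (by linarith))
      (fun y z α' m => by rw [hSEdef]; exact vertexE_inl_inr sf sm _ _ cΛ j X μ c y z α' m) (decays_mono hX1 hCX le_rfl (by linarith))
      (fun y₁ a m => by rw [hX]; exact hasSum_dressedStep_fm_col hLc1 hr sf sm (j + 1) y₁ a m) hA (fun u => biLoc_mono (hQ ν u) hCq (by linarith))
      (fun u s => by rw [hX]; exact borderSlot_translate (r := r) hLc1 sf sm (j + 1) hS'cov ν u s) (fun u z w b' b => vertexOfK_unitS_noFF_inl_inl X Lc sf sm hS'ff ν u z w b' b)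
      (fun u z w m b hz => borderSlot_inr_fst_eq_zero X sf sm hS'supp ν u z w m b hz) (fun y => by split_ifs <;> simp) (fun w => by split_ifs <;> simp)
      (fun w s => face_weight_periodic Lc β w s)]
    refine tsum_congr fun y₁ => Finset.sum_congr rfl fun a _ => ?_
    congr 1
    exact sum_fmCharge_mul (d := d) Lc sf sm (((((Lc ^ (j + 1 + 1) : ℕ) : ℝ)) ^ (d + 1 + 1))⁻¹)
      (fun m => ∑' uw : Site (d + 1) × Site (d + 1), (if uw.2 β % (Lc : ℤ) = (Lc : ℤ) - 1 then (1 : ℝ) else 0) * vertexOfK X Lc (unitS sf sm S') ν uw.1 0 uw.2 (Sum.inr m) (Sum.inl β)) y₁ a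
  simp only [hX, hSEdef] at hval
  rw [Finset.sum_congr rfl fun c _ => hval (toSite c)]
  exact sum_box_leftFamily_face_eq_zero_succ hLc hr sf sm cΛ j μ α _

/-- [folklore] **27_{j+1}, SWAP: THE `S′ ⊗ S^E` WORD, BORDER SLOT ON THE LATTICE BOND (LEFT), VANISHES IN THE ZERO MODE AT LEVEL `j+1`** (here `S′`'s multiplier SECOND legs sit on the coarse
lattice) — by transposition each bond's word is MINUS the §2 word with middle kernel `sgnK X̃♮_{j+1}`, slot `trK Q` and axes `(β, α)`; then §3 with the left face `β`. -/
theorem sum_box_border_E_swap_word_eq_zero_succ (hLc : 3 ≤ Lc) (hr : r ∈ box (d + 1) Lc) (sf sm cΛ : ℝ) (j : ℕ) (hS' : LocStencil S' Cs δs) (hδs : 0 < δs)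
    (hS'ff : ∀ (κ' : Fin (d + 1)) (t x z : Site (d + 1)) (α' a : Fin (d + 1)), S' κ' t x z (Sum.inl α') (Sum.inl a) = 0)
    (hS'cov : ∀ (κ : Fin (d + 1)) (u t : Site (d + 1)), S' κ (u + (Lc : ℤ) • t) = shiftK (-((Lc : ℤ) • t)) (S' κ u))
    (hS'supp : ∀ (κ : Fin (d + 1)) (t z w : Site (d + 1)) (a : Fib d) (m : Fin (d + 1)), off Lc w ≠ 0 → S' κ t z w a (Sum.inr m) = 0) :
    ∑ c ∈ box (d + 1) Lc, ∑' u' : Site (d + 1), ∑' yw : Site (d + 1) × Site (d + 1), (if yw.1 α % (Lc : ℤ) = (Lc : ℤ) - 1 then (1 : ℝ) else 0) * (if yw.2 β % (Lc : ℤ) = (Lc : ℤ) - 1 then (1 : ℝ) else 0) *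
        comp (comp (vertexOfK (unitK sf sm (coDressKBmAt (toSite r) Lc (KInvStep (d := d) Lc (j + 1)))) Lc (unitS sf sm S') ν u')
          (unitK sf sm (coDressKBmAt (toSite r) Lc (KInvStep (d := d) Lc (j + 1)))))
          (vertexOfK (unitK sf sm (coDressKBmAt (toSite r) Lc (KInvStep (d := d) Lc (j + 1)))) Lc
            (unitS sf sm (fun κ' t => ((Lc : ℝ) ^ (d + 1) * wE d Lc (j + 1)) • e3OfK Lc (coDressKBmAt (toSite r) Lc (KInvStep (d := d) Lc j))
              (SrecAt d Lc (toSite r) ((Lc : ℝ) ^ (d + 1)) (-((Lc : ℝ) ^ (d + 1) * (1 / 2) * (Lc : ℝ) ^ (d + 1))) cΛ j) κ' t)) μ (toSite c)) yw.1 yw.2 (Sum.inl α) (Sum.inl β) = 0 := by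
  classical
  have hLc1 : 1 ≤ Lc := le_trans (by norm_num) hLc
  set X := unitK sf sm (coDressKBmAt (toSite r) Lc (KInvStep (d := d) Lc (j + 1))) with hX
  set SE : Fin (d + 1) → Site (d + 1) → MKer (d + 1) (Fib d) := fun κ' t => ((Lc : ℝ) ^ (d + 1) * wE d Lc (j + 1)) •
    e3OfK Lc (coDressKBmAt (toSite r) Lc (KInvStep (d := d) Lc j)) (SrecAt d Lc (toSite r) ((Lc : ℝ) ^ (d + 1)) (-((Lc : ℝ) ^ (d + 1) * (1 / 2) * (Lc : ℝ) ^ (d + 1))) cΛ j) κ' t with hSEdef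
  set VE := vertexOfK X Lc (unitS sf sm SE) μ with hVEdef
  set Q := vertexOfK X Lc (unitS sf sm S') ν with hQdef
  -- common-rate data
  obtain ⟨δK, CK, hδK, hCK, hXd⟩ := decays_coDressKBmAt hLc1 hr (decays_KInvStep (d := d) (Lc := Lc) (j + 1))
  have hXu : Decays X (max |sf| |sm| * CK * max |sf| |sm|) δK := decays_unitK (sf := sf) (sm := sm) hXd
  have hCX : 0 ≤ max |sf| |sm| * CK * max |sf| |sm| := by positivity
  have hCs : 0 ≤ Cs := (hS' 0 0).nonneg (Sum.inl 0)
  obtain ⟨CE, δE, hδE, hSE0⟩ := exists_locStencil_e3Sector (d := d) hLc1 hr ((Lc : ℝ) ^ (d + 1)) (-((Lc : ℝ) ^ (d + 1) * (1 / 2) * (Lc : ℝ) ^ (d + 1))) cΛ j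
  have hCE : 0 ≤ CE := (hSE0 0 0).nonneg (Sum.inl 0)
  set δ₁ : ℝ := min δK (min δs δE) with hδ₁
  have hδ₁0 : 0 < δ₁ := lt_min hδK (lt_min hδs hδE)
  have hX1 : Decays X (max |sf| |sm| * CK * max |sf| |sm|) δ₁ := decays_mono hXu hCX le_rfl (min_le_left _ _)
  have hSE : LocStencil (unitS sf sm SE) _ δ₁ := locStencil_unitS (sf := sf) (sm := sm) (fun κ' u => biLoc_mono (hSE0 κ' u) hCE ((min_le_right _ _).trans (min_le_right _ _)))
  have hVE := vertexFamily_vertexOfK (N := Lc) hX1 hCX hSE hδ₁0 le_rfl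
  have hQf := vertexFamily_vertexOfK (N := Lc) hX1 hCX (locStencil_unitS (sf := sf) (sm := sm) (fun κ' u => biLoc_mono (hS' κ' u) hCs ((min_le_right _ _).trans (min_le_left _ _)))) hδ₁0 le_rfl
  have hCv := (hVE μ 0).nonneg (Sum.inl 0)
  have hCq := (hQf μ 0).nonneg (Sum.inl 0)
  have hX2 : Decays X (max |sf| |sm| * CK * max |sf| |sm|) (δ₁ / 2) := decays_mono hX1 hCX le_rfl (by linarith)
  have hXt : trK X = sgnK X := trK_unitK_coDress hr (j + 1) sf sm
  have hVEt : ∀ c : Site (d + 1), trK (VE c) = -VE c := fun c =>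
    trK_vertexOfK_of_antisymm (K := X) (N := Lc) (fun κ' u x z a b => by
      rw [hSEdef]; exact unitS_e3Sector_antisymm hLc1 hr sf sm _ _ cΛ j κ' u x z a b) μ c
  have hTX : Tame (sgnK X) := Spr.tame ⟨_, _, hδ₁0, decays_sgnK hX1⟩
  have hTVE : ∀ c : Site (d + 1), Tame (VE c) := fun c => Loc.tame ⟨_, _, _, _, half_pos hδ₁0, hVE μ c⟩
  have hTQ : ∀ u' : Site (d + 1), Tame (trK (Q u')) := fun u' => Loc.tame ⟨_, _, _, _, half_pos hδ₁0, biLoc_trK (hQf ν u')⟩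
  -- per bond of the first slot: transpose, then 27 §2 with the negated fm charges
  have hval : ∀ c : Site (d + 1), (∑' u' : Site (d + 1), ∑' yw : Site (d + 1) × Site (d + 1), (if yw.1 α % (Lc : ℤ) = (Lc : ℤ) - 1 then (1 : ℝ) else 0) * (if yw.2 β % (Lc : ℤ) = (Lc : ℤ) - 1 then (1 : ℝ) else 0) *
        comp (comp (Q u') X) (VE c) yw.1 yw.2 (Sum.inl α) (Sum.inl β)) =
      -∑' y₁ : Site (d + 1), ∑ a : Fin (d + 1), (∑' y : Site (d + 1), (if y β % (Lc : ℤ) = (Lc : ℤ) - 1 then (1 : ℝ) else 0) * VE c y y₁ (Sum.inl β) (Sum.inl a)) *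
        ((if y₁ a % (Lc : ℤ) = (Lc : ℤ) - 1 then (1 : ℝ) else 0) * (-(((Lc : ℝ) * (sm * sf)) * ((((Lc ^ (j + 1 + 1) : ℕ) : ℝ)) ^ (d + 1 + 1))⁻¹ *
          (∑' uw : Site (d + 1) × Site (d + 1), (if uw.2 α % (Lc : ℤ) = (Lc : ℤ) - 1 then (1 : ℝ) else 0) * trK (Q uw.1) 0 uw.2 (Sum.inr a) (Sum.inl α))))) := by
    intro c
    have e : ∀ u' : Site (d + 1), (∑' yw : Site (d + 1) × Site (d + 1), (if yw.1 α % (Lc : ℤ) = (Lc : ℤ) - 1 then (1 : ℝ) else 0) * (if yw.2 β % (Lc : ℤ) = (Lc : ℤ) - 1 then (1 : ℝ) else 0) *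
          comp (comp (Q u') X) (VE c) yw.1 yw.2 (Sum.inl α) (Sum.inl β)) =
        -∑' wy : Site (d + 1) × Site (d + 1), (if wy.1 β % (Lc : ℤ) = (Lc : ℤ) - 1 then (1 : ℝ) else 0) * (if wy.2 α % (Lc : ℤ) = (Lc : ℤ) - 1 then (1 : ℝ) else 0) *
          comp (comp (VE c) (sgnK X)) (trK (Q u')) wy.1 wy.2 (Sum.inl β) (Sum.inl α) := by
      intro u'
      refine (tsum_twoFace_eq_trK (comp (comp (Q u') X) (VE c)) (fun y : Site (d + 1) => (if y α % (Lc : ℤ) = (Lc : ℤ) - 1 then (1 : ℝ) else 0))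
        (fun w : Site (d + 1) => (if w β % (Lc : ℤ) = (Lc : ℤ) - 1 then (1 : ℝ) else 0)) (Sum.inl α) (Sum.inl β)).trans ?_
      rw [trK_comp, trK_comp, hXt, hVEt c, comp_neg_left, comp_assoc_tame (hTVE c) hTX (hTQ u'), ← tsum_neg]
      exact tsum_congr fun wy => by simp only [Pi.neg_apply]; ring
    rw [tsum_congr e, tsum_neg]
    congr 1
    have hB := biLoc_comp_right (hVE μ c) (decays_sgnK hX2) (show (0 : ℝ) ≤ δ₁ / 4 by positivity) (by linarith)
    rw [tsum_ffLeft_profile_right_word_eq (N := Lc) (α := β) (β := α) (Q := fun u' => trK (Q u'))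
      (ρ₁ := fun w : Site (d + 1) => (if w β % (Lc : ℤ) = (Lc : ℤ) - 1 then (1 : ℝ) else 0))
      (ρ₂ := fun y : Site (d + 1) => (if y α % (Lc : ℤ) = (Lc : ℤ) - 1 then (1 : ℝ) else 0)) (show (0 : ℝ) < δ₁ / 4 by positivity) (biLoc_mono (hVE μ c) hCv (by linarith))
      (fun y z α' m => by rw [hSEdef]; exact vertexE_inl_inr sf sm _ _ cΛ j X μ c y z α' m) (decays_mono (decays_sgnK hX1) hCX le_rfl (by linarith))
      (fun y₁ a m => by rw [hX]; exact hasSum_sgnK_dressedStep_fm_col hLc1 hr sf sm (j + 1) y₁ a m) hB (fun u => biLoc_trK (biLoc_mono (hQf ν u) hCq (by linarith)))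
      (fun u s => by show trK (Q (u + s)) = _; rw [hQdef, hX, borderSlot_translate (r := r) hLc1 sf sm (j + 1) hS'cov ν u s]; rfl)
      (fun u z w b' b => by rw [trK_apply]; exact vertexOfK_unitS_noFF_inl_inl X Lc sf sm hS'ff ν u w z b b')
      (fun u z w m b hz => by rw [trK_apply]; exact borderSlot_inr_snd_eq_zero X sf sm hS'supp ν u w z b m hz) (fun y => by split_ifs <;> simp) (fun w => by split_ifs <;> simp)
      (fun w s => face_weight_periodic Lc α w s)]
    refine tsum_congr fun y₁ => Finset.sum_congr rfl fun a _ => ?_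
    congr 1
    exact sum_neg_fmCharge_mul (d := d) Lc sf sm (((((Lc ^ (j + 1 + 1) : ℕ) : ℝ)) ^ (d + 1 + 1))⁻¹)
      (fun m => ∑' uw : Site (d + 1) × Site (d + 1), (if uw.2 α % (Lc : ℤ) = (Lc : ℤ) - 1 then (1 : ℝ) else 0) * trK (Q uw.1) 0 uw.2 (Sum.inr m) (Sum.inl α)) y₁ a
  simp only [hVEdef, hX, hSEdef] at hval
  rw [Finset.sum_congr rfl fun c _ => hval (toSite c), Finset.sum_neg_distrib, neg_eq_zero]
  exact sum_box_leftFamily_face_eq_zero_succ hLc hr sf sm cΛ j μ β _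

end Words

end Summit.QuantumFields.BalabanUV.Beta.GAN24.EVHLatticeWordsSucc

end
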